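import Summits.Ventures.PercRepro.C026TwoHubSources

/-!
# STEP 1 of THEOREM B, the Good sources: `Good_a` / `Good_b` on the two-hub skeleton (p6, gen 22)

For a `(D,A)` source `S` of `H = G.attachTwoHub a b h h'` (C026TwoHubSources, `DA_attach_iff`),
the blue cluster of the terminal `a` in `H` is exactly `a` together with the hub-graph blue clusters
of the hubs whose `a`-edge is blue (`cluster_compl_a_eq`; `cluster_compl_b_eq` for `b`), and
(mine-3's STEP 1, MINE3-GLUING.md §40 (j)) `S ∈ Good_a` — the other terminal `b` is red-reachable
from `c` by a walk avoiding that cluster — iff some `RR` hub (both terminal edges red) is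
red-reachable from `c` in the hub graph avoiding it (`goodA_attach_iff`; `goodB_attach_iff` for
`Good_b`): the walk's first entry into `{b}` is a red hub edge `x–b` with `x ∉ D_a`, so `x` is an
`RR` hub and the prefix is a hub-graph walk avoiding `D_a`; conversely the hub-graph walk followed
by the red edge `x–b` is such a walk.
-/

namespace PercRepro

namespace MultiGraph

open Finset

variable {V E : Type*} {G : MultiGraph V E} {a b h h' c : V}

/-- The end vertex of an avoiding walk is outside the avoided set. -/
theorem WalkAvoiding.not_mem_right {ω : Config E} {W : Set V} {u v : V}
    (hw : G.WalkAvoiding ω W u v) : v ∉ W := by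
  rcases hw with ⟨hu, hwalk⟩
  rcases hwalk.cases_tail with rfl | ⟨_, _, hlast⟩
  · exact hu
  · exact hlast.2

/-- A hub-graph walk avoiding `W` is a walk of the attachment avoiding `W`. -/
theorem walkAvoiding_attach_of_walkAvoiding {S : Config (E ⊕ Fin 5)} {W : Set V} {x y : V}
    (hw : G.WalkAvoiding (S ∘ Sum.inl) W x y) : (G.attachTwoHub a b h h').WalkAvoiding S W x y :=
  ⟨hw.1, reflTransGen_of_imp (fun _ _ hxy => ⟨openAdj_attach_of_openAdj hxy.1, hxy.2⟩) hw.2⟩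

/-- An avoiding walk also avoids any set whose points it never visits, given as a union. -/
theorem walkAvoiding_union_of_walkAvoiding {ω : Config E} {W Y : Set V} {u v : V}
    (hu : u ∉ Y) (hw : Relation.ReflTransGen (fun x y => (G.OpenAdj ω x y ∧ y ∉ W) ∧ y ∉ Y) u v)
    (huW : u ∉ W) : G.WalkAvoiding ω (W ∪ Y) u v :=
  ⟨fun hmem => hmem.elim huW hu,
    reflTransGen_of_imp (fun _ _ hxy => ⟨hxy.1.1, fun hmem => hmem.elim hxy.1.2 hxy.2⟩) hw⟩

section Good

variable (hab : a ≠ b) (hca : c ≠ a) (hcb : c ≠ b) (hha : h ≠ a) (hhb : h ≠ b) (hh'a : h' ≠ a)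
  (hh'b : h' ≠ b) (hisoa : ∀ e, G.fst e ≠ a ∧ G.snd e ≠ a) (hisob : ∀ e, G.fst e ≠ b ∧ G.snd e ≠ b)

/-- The easy inclusion: `a` and the hub-graph blue clusters of the hubs with a blue `a`-edge lie in
the blue cluster of `a`. -/
theorem subset_cluster_compl_a {S : Config (E ⊕ Fin 5)} :
    {a} ∪ {v | S (Sum.inr 0) = false ∧ v ∈ G.cluster (S ∘ Sum.inl)ᶜ h} ∪
        {v | S (Sum.inr 2) = false ∧ v ∈ G.cluster (S ∘ Sum.inl)ᶜ h'} ⊆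
      (G.attachTwoHub a b h h').cluster Sᶜ a := by
  rintro v ((hv | ⟨h0, hm⟩) | ⟨h2, hm⟩)
  · rw [Set.mem_singleton_iff] at hv
    rw [hv]
    exact (G.attachTwoHub a b h h').self_mem_cluster _ a
  · exact (G.attachTwoHub a b h h').mem_cluster.2
      ((Conn.of_openAdj (openAdj_attach_compl_inr (G := G) (a := a) (b := b) (h := h) (h' := h')
        h0)).symm.trans (conn_attach_compl_of_conn ((G.mem_cluster).1 hm)))
  · exact (G.attachTwoHub a b h h').mem_cluster.2
      ((Conn.of_openAdj (openAdj_attach_compl_inr (G := G) (a := a) (b := b) (h := h) (h' := h')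
        h2)).symm.trans (conn_attach_compl_of_conn ((G.mem_cluster).1 hm)))

/-- The easy inclusion for `b`. -/
theorem subset_cluster_compl_b {S : Config (E ⊕ Fin 5)} :
    {b} ∪ {v | S (Sum.inr 1) = false ∧ v ∈ G.cluster (S ∘ Sum.inl)ᶜ h} ∪
        {v | S (Sum.inr 3) = false ∧ v ∈ G.cluster (S ∘ Sum.inl)ᶜ h'} ⊆
      (G.attachTwoHub a b h h').cluster Sᶜ b := by
  rintro v ((hv | ⟨h1, hm⟩) | ⟨h3, hm⟩)
  · rw [Set.mem_singleton_iff] at hv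
    rw [hv]
    exact (G.attachTwoHub a b h h').self_mem_cluster _ b
  · exact (G.attachTwoHub a b h h').mem_cluster.2
      ((Conn.of_openAdj (openAdj_attach_compl_inr (G := G) (a := a) (b := b) (h := h) (h' := h')
        h1)).symm.trans (conn_attach_compl_of_conn ((G.mem_cluster).1 hm)))
  · exact (G.attachTwoHub a b h h').mem_cluster.2
      ((Conn.of_openAdj (openAdj_attach_compl_inr (G := G) (a := a) (b := b) (h := h) (h' := h')
        h3)).symm.trans (conn_attach_compl_of_conn ((G.mem_cluster).1 hm)))

include hab hha hhb hh'a hh'b hisoa hisob in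
/-- **The blue cluster of the terminal `b`** is contained in `b` together with the hub-graph blue
clusters of the hubs whose `b`-edge is blue (the mirror of `cluster_compl_a_subset`). -/
theorem cluster_compl_b_subset {S : Config (E ⊕ Fin 5)} (h4 : S (Sum.inr 4) = true)
    (h01 : S (Sum.inr 0) = true ∨ S (Sum.inr 1) = true)
    (h23 : S (Sum.inr 2) = true ∨ S (Sum.inr 3) = true)
    (hB03 : S (Sum.inr 0) = false → S (Sum.inr 3) = false → ¬ G.Conn (S ∘ Sum.inl)ᶜ h h')
    (hB12 : S (Sum.inr 1) = false → S (Sum.inr 2) = false → ¬ G.Conn (S ∘ Sum.inl)ᶜ h h') :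
    (G.attachTwoHub a b h h').cluster Sᶜ b ⊆
      {b} ∪ {v | S (Sum.inr 1) = false ∧ v ∈ G.cluster (S ∘ Sum.inl)ᶜ h} ∪
        {v | S (Sum.inr 3) = false ∧ v ∈ G.cluster (S ∘ Sum.inl)ᶜ h'} := by
  intro v hv
  refine mem_of_conn_of_closed_boundary ?_ (by simp) ((G.attachTwoHub a b h h').mem_cluster.1 hv)
  intro f hf
  rcases f with e | i
  · simp only [attachTwoHub_fst_inl, attachTwoHub_snd_inl, Set.mem_union, Set.mem_singleton_iff,
      Set.mem_setOf_eq]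
    have hf' : (S ∘ Sum.inl)ᶜ e = true := by rw [← compl_comp_inl]; exact hf
    have heb := (hisob e).1
    have heb' := (hisob e).2
    have hh := mem_cluster_iff_of_open (ω := (S ∘ Sum.inl)ᶜ) (G := G) (a := h) hf'
    have hh' := mem_cluster_iff_of_open (ω := (S ∘ Sum.inl)ᶜ) (G := G) (a := h') hf'
    constructor
    · rintro ((h1 | ⟨h0, hm⟩) | ⟨h2, hm⟩)
      · exact absurd h1 heb
      · exact Or.inl (Or.inr ⟨h0, hh.1 hm⟩)
      · exact Or.inr ⟨h2, hh'.1 hm⟩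
    · rintro ((h1 | ⟨h0, hm⟩) | ⟨h2, hm⟩)
      · exact absurd h1 heb'
      · exact Or.inl (Or.inr ⟨h0, hh.2 hm⟩)
      · exact Or.inr ⟨h2, hh'.2 hm⟩
  · rw [compl_apply_not, Bool.not_eq_true'] at hf
    have hah : a ∉ G.cluster (S ∘ Sum.inl)ᶜ h := not_mem_cluster_of_isolated hisoa hha
    have hah' : a ∉ G.cluster (S ∘ Sum.inl)ᶜ h' := not_mem_cluster_of_isolated hisoa hh'a
    fin_cases i
    · -- `h–a` blue: both endpoints outside
      simp only [attachTwoHub_fst_inr, attachTwoHub_snd_inr, Set.mem_union,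
        Set.mem_singleton_iff, Set.mem_setOf_eq]
      refine iff_of_false ?_ ?_
      · rintro ((h1 | ⟨h1, _⟩) | ⟨h3, hm⟩)
        · exact hhb h1
        · simp only [h1, Bool.false_eq_true, or_false] at h01
          exact Bool.false_ne_true (hf.symm.trans h01)
        · exact hB03 hf h3 ((G.mem_cluster).1 hm).symm
      · rintro ((h1 | ⟨_, hm⟩) | ⟨_, hm⟩)
        · exact hab h1
        · exact hah hm
        · exact hah' hm
    · -- `h–b` blue: both endpoints inside
      simp only [attachTwoHub_fst_inr, attachTwoHub_snd_inr, Set.mem_union,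
        Set.mem_singleton_iff, Set.mem_setOf_eq]
      exact iff_of_true (Or.inl (Or.inr ⟨hf, G.self_mem_cluster _ h⟩)) (Or.inl (Or.inl rfl))
    · -- `h'–a` blue: both endpoints outside
      simp only [attachTwoHub_fst_inr, attachTwoHub_snd_inr, Set.mem_union,
        Set.mem_singleton_iff, Set.mem_setOf_eq]
      refine iff_of_false ?_ ?_
      · rintro ((h1 | ⟨h1, hm⟩) | ⟨h3, _⟩)
        · exact hh'b h1
        · exact hB12 h1 hf ((G.mem_cluster).1 hm)
        · simp only [h3, Bool.false_eq_true, or_false] at h23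
          exact Bool.false_ne_true (hf.symm.trans h23)
      · rintro ((h1 | ⟨_, hm⟩) | ⟨_, hm⟩)
        · exact hab h1
        · exact hah hm
        · exact hah' hm
    · -- `h'–b` blue: both endpoints inside
      simp only [attachTwoHub_fst_inr, attachTwoHub_snd_inr, Set.mem_union,
        Set.mem_singleton_iff, Set.mem_setOf_eq]
      exact iff_of_true (Or.inr ⟨hf, G.self_mem_cluster _ h'⟩) (Or.inl (Or.inl rfl))
    · exact absurd (hf.symm.trans h4) Bool.false_ne_true

include hab hha hhb hh'a hh'b hisoa hisob in
/-- **The blue cluster of `a` in the two-hub skeleton**, exactly, for a source. -/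
theorem cluster_compl_a_eq {S : Config (E ⊕ Fin 5)} (h4 : S (Sum.inr 4) = true)
    (h01 : S (Sum.inr 0) = true ∨ S (Sum.inr 1) = true)
    (h23 : S (Sum.inr 2) = true ∨ S (Sum.inr 3) = true)
    (hB03 : S (Sum.inr 0) = false → S (Sum.inr 3) = false → ¬ G.Conn (S ∘ Sum.inl)ᶜ h h')
    (hB12 : S (Sum.inr 1) = false → S (Sum.inr 2) = false → ¬ G.Conn (S ∘ Sum.inl)ᶜ h h') :
    (G.attachTwoHub a b h h').cluster Sᶜ a =
      {a} ∪ {v | S (Sum.inr 0) = false ∧ v ∈ G.cluster (S ∘ Sum.inl)ᶜ h} ∪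
        {v | S (Sum.inr 2) = false ∧ v ∈ G.cluster (S ∘ Sum.inl)ᶜ h'} :=
  Set.Subset.antisymm (cluster_compl_a_subset hab hha hhb hh'a hh'b hisoa hisob h4 h01 h23 hB03 hB12)
    subset_cluster_compl_a

include hab hha hhb hh'a hh'b hisoa hisob in
/-- **The blue cluster of `b` in the two-hub skeleton**, exactly, for a source. -/
theorem cluster_compl_b_eq {S : Config (E ⊕ Fin 5)} (h4 : S (Sum.inr 4) = true)
    (h01 : S (Sum.inr 0) = true ∨ S (Sum.inr 1) = true)
    (h23 : S (Sum.inr 2) = true ∨ S (Sum.inr 3) = true)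
    (hB03 : S (Sum.inr 0) = false → S (Sum.inr 3) = false → ¬ G.Conn (S ∘ Sum.inl)ᶜ h h')
    (hB12 : S (Sum.inr 1) = false → S (Sum.inr 2) = false → ¬ G.Conn (S ∘ Sum.inl)ᶜ h h') :
    (G.attachTwoHub a b h h').cluster Sᶜ b =
      {b} ∪ {v | S (Sum.inr 1) = false ∧ v ∈ G.cluster (S ∘ Sum.inl)ᶜ h} ∪
        {v | S (Sum.inr 3) = false ∧ v ∈ G.cluster (S ∘ Sum.inl)ᶜ h'} :=
  Set.Subset.antisymm (cluster_compl_b_subset hab hha hhb hh'a hh'b hisoa hisob h4 h01 h23 hB03 hB12)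
    subset_cluster_compl_b

include hab hca hcb hha hhb hh'a hh'b hisoa hisob in
/-- **STEP 1 of THEOREM B, `Good_a`**: for a `(D,A)` source of the two-hub skeleton, `b` is
red-reachable from `c` avoiding the blue cluster `D_a` of `a` iff an `RR` hub is red-reachable from
`c` in the hub graph avoiding `D_a` (given by `cluster_compl_a_eq`). -/
theorem goodA_attach_iff {S : Config (E ⊕ Fin 5)}
    (hS : ((G.attachTwoHub a b h h').Conn S c a ∧ (G.attachTwoHub a b h h').Conn S c b) ∧
      (¬ (G.attachTwoHub a b h h').Conn Sᶜ c a ∧ ¬ (G.attachTwoHub a b h h').Conn Sᶜ c b ∧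
        ¬ (G.attachTwoHub a b h h').Conn Sᶜ a b)) :
    (G.attachTwoHub a b h h').WalkAvoiding S ((G.attachTwoHub a b h h').cluster Sᶜ a) c b ↔
      ((S (Sum.inr 0) = true ∧ S (Sum.inr 1) = true ∧
          G.WalkAvoiding (S ∘ Sum.inl) ({a} ∪
            {v | S (Sum.inr 0) = false ∧ v ∈ G.cluster (S ∘ Sum.inl)ᶜ h} ∪
            {v | S (Sum.inr 2) = false ∧ v ∈ G.cluster (S ∘ Sum.inl)ᶜ h'}) c h) ∨
        (S (Sum.inr 2) = true ∧ S (Sum.inr 3) = true ∧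
          G.WalkAvoiding (S ∘ Sum.inl) ({a} ∪
            {v | S (Sum.inr 0) = false ∧ v ∈ G.cluster (S ∘ Sum.inl)ᶜ h} ∪
            {v | S (Sum.inr 2) = false ∧ v ∈ G.cluster (S ∘ Sum.inl)ᶜ h'}) c h')) := by
  obtain ⟨h4, h01, h23, -, -, -, -, -, hB03, hB12⟩ :=
    (DA_attach_iff hab hca hcb hha hhb hh'a hh'b hisoa hisob S).1 hS
  have hDa := cluster_compl_a_eq hab hha hhb hh'a hh'b hisoa hisob h4 h01 h23 hB03 hB12
  have hbDa : b ∉ (G.attachTwoHub a b h h').cluster Sᶜ a := fun hmem =>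
    hS.2.2.2 ((G.attachTwoHub a b h h').mem_cluster.1 hmem)
  have haDa : a ∈ (G.attachTwoHub a b h h').cluster Sᶜ a :=
    (G.attachTwoHub a b h h').self_mem_cluster _ a
  constructor
  · intro hw
    have hcb' : c ∉ ({b} : Set V) := by simpa using hcb
    obtain ⟨x, hx, w, hw', hwalk, hxw⟩ := exists_entry hw.2 hcb' (Set.mem_singleton b)
    rw [Set.mem_singleton_iff] at hw'
    rw [hw'] at hxw
    have hwalk' : (G.attachTwoHub a b h h').WalkAvoiding S
        ((G.attachTwoHub a b h h').cluster Sᶜ a ∪ {b}) c x :=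
      walkAvoiding_union_of_walkAvoiding hcb' hwalk hw.1
    have hxDa : x ∉ (G.attachTwoHub a b h h').cluster Sᶜ a := fun hmem =>
      hwalk'.not_mem_right (Or.inl hmem)
    have hG : G.WalkAvoiding (S ∘ Sum.inl) ((G.attachTwoHub a b h h').cluster Sᶜ a ∪ {b}) c x :=
      (walkAvoiding_attach_iff (W := (G.attachTwoHub a b h h').cluster Sᶜ a ∪ {b})
        (Set.mem_union_left _ haDa) (Set.mem_union_right _ (Set.mem_singleton b))).1 hwalk'
    have hG' : G.WalkAvoiding (S ∘ Sum.inl) ((G.attachTwoHub a b h h').cluster Sᶜ a) c x :=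
      hG.mono_set Set.subset_union_left
    rw [hDa] at hG'
    rw [Set.mem_singleton_iff] at hx
    obtain ⟨f, hf, hend⟩ := hxw.1
    rcases f with e | i
    · exfalso
      rcases hend with ⟨_, h2⟩ | ⟨h1, _⟩
      · exact (hisob e).2 h2
      · exact (hisob e).1 h1
    · fin_cases i
      · exfalso
        rcases hend with ⟨_, h2⟩ | ⟨h1, _⟩
        · exact hab (show a = b from h2)
        · exact hhb (show h = b from h1)
      · rcases hend with ⟨h1, _⟩ | ⟨h1, _⟩
        · have hxh : x = h := (show h = x from h1).symm
          rw [hxh] at hG' hxDa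
          refine Or.inl ⟨?_, hf, hG'⟩
          by_contra h0
          rw [Bool.not_eq_true] at h0
          exact hxDa (subset_cluster_compl_a (Or.inl (Or.inr ⟨h0, G.self_mem_cluster _ h⟩)))
        · exact absurd (show h = b from h1) hhb
      · exfalso
        rcases hend with ⟨_, h2⟩ | ⟨h1, _⟩
        · exact hab (show a = b from h2)
        · exact hh'b (show h' = b from h1)
      · rcases hend with ⟨h1, _⟩ | ⟨h1, _⟩
        · have hxh : x = h' := (show h' = x from h1).symm
          rw [hxh] at hG' hxDa
          refine Or.inr ⟨?_, hf, hG'⟩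
          by_contra h2
          rw [Bool.not_eq_true] at h2
          exact hxDa (subset_cluster_compl_a (Or.inr ⟨h2, G.self_mem_cluster _ h'⟩))
        · exact absurd (show h' = b from h1) hh'b
      · exfalso
        rcases hend with ⟨h1, _⟩ | ⟨h1, _⟩
        · exact hxDa ((show a = x from h1) ▸ haDa)
        · exact hab (show a = b from h1)
  · rintro (⟨h0, h1, hG⟩ | ⟨h2, h3, hG⟩)
    · rw [← hDa] at hG
      have := walkAvoiding_attach_of_walkAvoiding (a := a) (b := b) (h := h) (h' := h') hG
      exact ⟨this.1, this.2.tail ⟨openAdj_attach_inr (G := G) (a := a) (b := b) (h := h) (h' := h')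
        h1, hbDa⟩⟩
    · rw [← hDa] at hG
      have := walkAvoiding_attach_of_walkAvoiding (a := a) (b := b) (h := h) (h' := h') hG
      exact ⟨this.1, this.2.tail ⟨openAdj_attach_inr (G := G) (a := a) (b := b) (h := h) (h' := h')
        h3, hbDa⟩⟩

include hab hca hcb hha hhb hh'a hh'b hisoa hisob in
/-- **STEP 1 of THEOREM B, `Good_b`**: the mirror of `goodA_attach_iff`. -/
theorem goodB_attach_iff {S : Config (E ⊕ Fin 5)}
    (hS : ((G.attachTwoHub a b h h').Conn S c a ∧ (G.attachTwoHub a b h h').Conn S c b) ∧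
      (¬ (G.attachTwoHub a b h h').Conn Sᶜ c a ∧ ¬ (G.attachTwoHub a b h h').Conn Sᶜ c b ∧
        ¬ (G.attachTwoHub a b h h').Conn Sᶜ a b)) :
    (G.attachTwoHub a b h h').WalkAvoiding S ((G.attachTwoHub a b h h').cluster Sᶜ b) c a ↔
      ((S (Sum.inr 0) = true ∧ S (Sum.inr 1) = true ∧
          G.WalkAvoiding (S ∘ Sum.inl) ({b} ∪
            {v | S (Sum.inr 1) = false ∧ v ∈ G.cluster (S ∘ Sum.inl)ᶜ h} ∪
            {v | S (Sum.inr 3) = false ∧ v ∈ G.cluster (S ∘ Sum.inl)ᶜ h'}) c h) ∨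
        (S (Sum.inr 2) = true ∧ S (Sum.inr 3) = true ∧
          G.WalkAvoiding (S ∘ Sum.inl) ({b} ∪
            {v | S (Sum.inr 1) = false ∧ v ∈ G.cluster (S ∘ Sum.inl)ᶜ h} ∪
            {v | S (Sum.inr 3) = false ∧ v ∈ G.cluster (S ∘ Sum.inl)ᶜ h'}) c h')) := by
  obtain ⟨h4, h01, h23, -, -, -, -, -, hB03, hB12⟩ :=
    (DA_attach_iff hab hca hcb hha hhb hh'a hh'b hisoa hisob S).1 hS
  have hDb := cluster_compl_b_eq hab hha hhb hh'a hh'b hisoa hisob h4 h01 h23 hB03 hB12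
  have haDb : a ∉ (G.attachTwoHub a b h h').cluster Sᶜ b := fun hmem =>
    hS.2.2.2 ((G.attachTwoHub a b h h').mem_cluster.1 hmem).symm
  have hbDb : b ∈ (G.attachTwoHub a b h h').cluster Sᶜ b :=
    (G.attachTwoHub a b h h').self_mem_cluster _ b
  constructor
  · intro hw
    have hca' : c ∉ ({a} : Set V) := by simpa using hca
    obtain ⟨x, hx, w, hw', hwalk, hxw⟩ := exists_entry hw.2 hca' (Set.mem_singleton a)
    rw [Set.mem_singleton_iff] at hw'
    rw [hw'] at hxw
    have hwalk' : (G.attachTwoHub a b h h').WalkAvoiding S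
        ((G.attachTwoHub a b h h').cluster Sᶜ b ∪ {a}) c x :=
      walkAvoiding_union_of_walkAvoiding hca' hwalk hw.1
    have hxDb : x ∉ (G.attachTwoHub a b h h').cluster Sᶜ b := fun hmem =>
      hwalk'.not_mem_right (Or.inl hmem)
    have hG : G.WalkAvoiding (S ∘ Sum.inl) ((G.attachTwoHub a b h h').cluster Sᶜ b ∪ {a}) c x :=
      (walkAvoiding_attach_iff (W := (G.attachTwoHub a b h h').cluster Sᶜ b ∪ {a})
        (Set.mem_union_right _ (Set.mem_singleton a)) (Set.mem_union_left _ hbDb)).1 hwalk'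
    have hG' : G.WalkAvoiding (S ∘ Sum.inl) ((G.attachTwoHub a b h h').cluster Sᶜ b) c x :=
      hG.mono_set Set.subset_union_left
    rw [hDb] at hG'
    rw [Set.mem_singleton_iff] at hx
    obtain ⟨f, hf, hend⟩ := hxw.1
    rcases f with e | i
    · exfalso
      rcases hend with ⟨_, h2⟩ | ⟨h1, _⟩
      · exact (hisoa e).2 h2
      · exact (hisoa e).1 h1
    · fin_cases i
      · rcases hend with ⟨h1, _⟩ | ⟨h1, _⟩
        · have hxh : x = h := (show h = x from h1).symm
          rw [hxh] at hG' hxDb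
          refine Or.inl ⟨hf, ?_, hG'⟩
          by_contra h1'
          rw [Bool.not_eq_true] at h1'
          exact hxDb (subset_cluster_compl_b (Or.inl (Or.inr ⟨h1', G.self_mem_cluster _ h⟩)))
        · exact absurd (show h = a from h1) hha
      · exfalso
        rcases hend with ⟨_, h2⟩ | ⟨h1, _⟩
        · exact hab (show b = a from h2).symm
        · exact hha (show h = a from h1)
      · rcases hend with ⟨h1, _⟩ | ⟨h1, _⟩
        · have hxh : x = h' := (show h' = x from h1).symm
          rw [hxh] at hG' hxDb
          refine Or.inr ⟨hf, ?_, hG'⟩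
          by_contra h3
          rw [Bool.not_eq_true] at h3
          exact hxDb (subset_cluster_compl_b (Or.inr ⟨h3, G.self_mem_cluster _ h'⟩))
        · exact absurd (show h' = a from h1) hh'a
      · exfalso
        rcases hend with ⟨_, h2⟩ | ⟨h1, _⟩
        · exact hab (show b = a from h2).symm
        · exact hh'a (show h' = a from h1)
      · exfalso
        rcases hend with ⟨h1, _⟩ | ⟨_, h2⟩
        · exact hx (show a = x from h1).symm
        · exact hxDb ((show b = x from h2) ▸ hbDb)
  · rintro (⟨h0, h1, hG⟩ | ⟨h2, h3, hG⟩)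
    · rw [← hDb] at hG
      have := walkAvoiding_attach_of_walkAvoiding (a := a) (b := b) (h := h) (h' := h') hG
      exact ⟨this.1, this.2.tail ⟨openAdj_attach_inr (G := G) (a := a) (b := b) (h := h) (h' := h')
        h0, haDb⟩⟩
    · rw [← hDb] at hG
      have := walkAvoiding_attach_of_walkAvoiding (a := a) (b := b) (h := h) (h' := h') hG
      exact ⟨this.1, this.2.tail ⟨openAdj_attach_inr (G := G) (a := a) (b := b) (h := h) (h' := h')
        h2, haDb⟩⟩

end Good

end MultiGraph

end PercRepro
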